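import Summits.BirchSwinnertonDyer.BirchSwinnertonDyer.Theorems.KolyvaginDepthDoorMSymbolCertUniqueFChunks
import HarnessLib

/-!
# Route `KolyvaginDepthDoor`, crux `KolyvaginDepthSupplyKN` (stmt-BirchSwinnertonDyer-22820) —
# DEPTH TABLE v27, KIT 2e/4: the cover, core-matrix and inverse checks BY ROWS

Helper file of the lead prover of line `levelone` (kdd-p1 g31; `--supports stmt-BirchSwinnertonDyer-22820
--as helper`); it closes nothing and BSD is NOT proved by it.

Kit 2d chunked the peeling and the pool; at level `N ≈ 1000` (core `m ≈ 86`) the three quadratic checks of kit 2c —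
`partCover` (`X` memberships in a list of length `X`), `partCore` and `partInv` (`(m-1)²` entries) — also exceed the
kernel's per-declaration memory bound. This file states them ROW BY ROW (`coreRow`, `invRow`) and from pointwise
membership, with range-chunk lemmas, so that a data file checks a few rows per `decide +kernel`. Pure bookkeeping.
-/

set_option linter.dupNamespace false

namespace Summit.BirchSwinnertonDyer.BirchSwinnertonDyer.Theorems.KolyvaginDepthDoor.MSymbolCert

/-- A membership chunk `lo ≤ i < lo + len` from its Boolean check on `List.range' lo len`. [folklore] -/
theorem mem_chunk {known : List ℕ} {lo len : ℕ}
    (h : (List.range' lo len).all (fun i => decide (i ∈ known)) = true) :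
    ∀ i, lo ≤ i → i < lo + len → i ∈ known := by
  intro i h1 h2
  simp only [List.all_eq_true, List.mem_range'_1, decide_eq_true_eq] at h
  exact h i ⟨h1, h2⟩

namespace CertF

variable (C : CertF)

/-- **`partCover` from pointwise membership** and the (short) core-equation membership check. [folklore] -/
theorem partCover_of_forall (gen : ℕ → Eqn) (X : ℕ) (known : List ℕ) (h1 : ∀ i < X, i ∈ known)
    (h2 : C.coreEqs.all (fun k => (gen k).all fun jc => decide (jc.1 ∈ known)) = true) :
    C.partCover gen X known = true := by
  simp only [partCover, Bool.and_eq_true, List.all_eq_true, List.mem_range, decide_eq_true_eq]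
  simp only [List.all_eq_true, decide_eq_true_eq] at h2
  exact ⟨fun i hi => h1 i hi, h2⟩

/-- Row `r` of the core-matrix check: `aTab r t = comb (gen e_r) (t+1)` for `t < m - 1`. [folklore] -/
def coreRow (gen : ℕ → Eqn) (r : ℕ) : Bool :=
  (List.range (C.m - 1)).all fun t => C.aTab r t == C.comb (gen (C.coreEqs.getD r 0)) (t + 1)

/-- Row `r` of the inverse check: `(A' B)_{r s} ≡ δ_{r s} (mod q)` for `s < m - 1`. [folklore] -/
def invRow (r : ℕ) : Bool :=
  (List.range (C.m - 1)).all fun s => C.abEntry r s % (C.q : ℤ) == if r = s then 1 else 0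

/-- **`partCore` from its rows.** [folklore] -/
theorem partCore_of_forall (gen : ℕ → Eqn) (h : ∀ r < C.m - 1, C.coreRow gen r = true) :
    C.partCore gen = true := by
  simp only [partCore, List.all_eq_true, List.mem_range]
  intro r hr
  have := h r hr
  simp only [coreRow, List.all_eq_true, List.mem_range] at this
  exact this

/-- **`partInv` from its rows.** [folklore] -/
theorem partInv_of_forall (h : ∀ r < C.m - 1, C.invRow r = true) : C.partInv = true := by
  simp only [partInv, List.all_eq_true, List.mem_range]
  intro r hr
  have := h r hr
  simp only [invRow, List.all_eq_true, List.mem_range] at this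
  exact this

/-- A chunk of core rows `lo ≤ r < lo + len` from its Boolean check. [folklore] -/
theorem coreRow_chunk (gen : ℕ → Eqn) {lo len : ℕ}
    (h : (List.range' lo len).all (fun r => C.coreRow gen r) = true) :
    ∀ r, lo ≤ r → r < lo + len → C.coreRow gen r = true := by
  intro r h1 h2
  simp only [List.all_eq_true, List.mem_range'_1] at h
  exact h r ⟨h1, h2⟩

/-- A chunk of inverse rows `lo ≤ r < lo + len` from its Boolean check. [folklore] -/
theorem invRow_chunk {lo len : ℕ} (h : (List.range' lo len).all (fun r => C.invRow r) = true) :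
    ∀ r, lo ≤ r → r < lo + len → C.invRow r = true := by
  intro r h1 h2
  simp only [List.all_eq_true, List.mem_range'_1] at h
  exact h r ⟨h1, h2⟩

/-- **`partCover` from pointwise membership and an index bound** (every unknown of a core equation is `< X`, a cheap
check; membership then follows from the cover). [folklore] -/
theorem partCover_of_forall_lt (gen : ℕ → Eqn) (X : ℕ) (known : List ℕ) (h1 : ∀ i < X, i ∈ known)
    (h2 : C.coreEqs.all (fun k => (gen k).all fun jc => decide (jc.1 < X)) = true) :
    C.partCover gen X known = true := by
  refine C.partCover_of_forall gen X known h1 ?_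
  simp only [List.all_eq_true, decide_eq_true_eq] at h2 ⊢
  exact fun k hk jc hjc => h1 _ (h2 k hk jc hjc)

end CertF

end Summit.BirchSwinnertonDyer.BirchSwinnertonDyer.Theorems.KolyvaginDepthDoor.MSymbolCert
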